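import Summits.Ventures.HSemireg.WedgeHankelRecurrenceAffinePolar
import Summits.Ventures.HSemireg.WedgeHankelRecurrenceInversion

/-!
# Venture HSemireg — TRUNCATION AND SHIFT: WHICH END OF THE CLASS CARRIES THE RANK.  Passing from `q_0, …, q_{N+1}` to `q_0, …, q_N` (dropping the TOP coefficient) **lowers the middle
# rank by one iff the class has a node at infinity** (minimal recurrence of degree `< R`), keeping the minimal recurrence; passing to `q_1, …, q_{N+1}` (the SHIFT, dropping `q_0`) **lowers it
# by one iff `0` is a root of the minimal recurrence** — each end of the coefficient string holds exactly the simple multiplicity of its own node (`∞`, resp. `0`)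

HONEST FRAMING. Part of the Lean index of the computation cell `pub-hsemireg` (seat p10 gen 27, Sunday typer «UNIFORM-IN-n»).
LINEAR ALGEBRA OF HANKEL (catalecticant) MATRICES and of polynomials over a field ONLY: no variety, no cohomology theory, no sheaf, no Ext group and no semiregularity map is constructed
here; nothing here says that HC / HC_CM / HC_AV holds; no Literature fact is declared or used.  Custodian versions as in `WedgeHankelSiegelIdeal` (1/3); the dictionary (`R^N(q) = rank
H^N_{⌊N/2⌋}(q)` the middle rank of the class on `[0, N]`; `σ` = th-7's shift; `rev_N` = E7's reversal; nodes `0`, `∞` of the rational normal curve) is QUOTED, never asserted.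

WHAT IS KEYED.  N34 (`WedgeHankelRecurrenceAffinePolar`, № 267): the structure theorems `rank_half_eq_and_mem_recSpace_iff_exists_affine_polar` / `…_iff_exists_affine`, `rank_hankel1_half_congr`;
N38 (`WedgeHankelRecurrenceInversion`, claim #8): `rank_hankel1_half_rev`, `recSpace_rev_eq_span_reflect`; N29 (№ 237) `mem_recSpace_succ_succ_iff`; N18 (№ 173):
`recSpace`, `mem_recSpace_iff`, `exists_recSpace_self_eq_span`, `natDegree_le_of_mem_recSpace`; th-7 `Hankel.shift`, E7 `rev`.  Mathlib: `Polynomial.monic_mul_leadingCoeff_inv`,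
`natDegree_mul_leadingCoeff_inv`, `coeff_reflect`, `reflect_reflect`, `natDegree_reflect_le`.
THIS FILE (namespace `Summit.Ventures.HSemireg.Wedge.HankelOuter` continued; CHAINED on N34 + N38; 0 definitions):
* §526 `recSpace_succ_le` (`Rec^{N+1}_k(q) ⊆ Rec^N_k(q)`), `exists_monic_mem_recSpace` (a non-zero recurrence normalises to a monic one on the same line).
* §527 TRUNCATION: **`rank_half_of_succ_of_polar`** (`R^{N+1}(q) = d + e`, `1 ≤ e`, `0 ≠ m ∈ Rec^{N+1}_{d+e}(q)` of degree `d`, `2(d + e) ≤ N + 2 ⇒ R^N(q) = d + (e − 1)` and `m ∈ Rec^N_{d+e−1}(q)`: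
  DROPPING THE TOP COEFFICIENT REMOVES ONE POINT AT INFINITY), **`rank_half_of_succ_of_affine`** (`R^{N+1}(q) = d` with `m` of full degree `d`, `2d ≤ N + 1 ⇒ R^N(q) = d`: no node at infinity,
  nothing lost).
* §528 SHIFT: `shift_eq_rev_rev` (`σq = rev_N (rev_{N+1} q)` on `[0, N]`), `natDegree_reflect_eq_of_coeff_zero_ne` / `natDegree_reflect_lt_of_coeff_zero_eq` (the constant term of `m` is
  the top coefficient of `reflect_r m`), **`rank_half_shift_of_coeff_zero_ne`** (`R^{N+1}(q) = r`, `0 ≠ m ∈ Rec^{N+1}_r(q)`, `m(0) ≠ 0`, `2r ≤ N + 1 ⇒ R^N(σq) = r`),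
  **`rank_half_shift_of_coeff_zero_eq`** (`m(0) = 0`, `1 ≤ r`, `2r ≤ N + 2 ⇒ R^N(σq) + 1 = r`: THE SHIFT REMOVES ONE POINT AT THE NODE `0`).
READING: N33/N34 located the node `∞` in the top coefficients and N38 moved it to `0` by inversion; this file reads both facts dynamically: shortening the string of coefficients at either
end peels exactly one unit of multiplicity off the node sitting at that end and nothing else.  Nothing Ext-side.  New names only.
-/

open Module Polynomial
open scoped Matrix Polynomial

namespace Summit.Ventures.HSemireg.Wedge.HankelOuter

open Summit.Ventures.HSemireg.Wedge Summit.Ventures.HSemireg.Wedge.Hankel Summit.Ventures.HSemireg.Wedge.HankelFrameChange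

variable (K : Type*) [Field K] {N : ℕ}

/-! ## §526. Levels and normalisation -/

/-- `Rec^{N+1}_k(q) ⊆ Rec^N_k(q)`: a longer string of coefficients imposes more recurrence conditions. -/
theorem recSpace_succ_le (q : ℕ → K) (k : ℕ) : recSpace K (N + 1) q k ≤ recSpace K N q k := by
  intro p hp
  rw [mem_recSpace_iff] at hp ⊢
  exact ⟨hp.1, fun s hs => hp.2 s (by omega)⟩

/-- a non-zero recurrence normalises to a MONIC one of the same degree on the same line. -/
theorem exists_monic_mem_recSpace {k : ℕ} {q : ℕ → K} {m : K[X]} (hm : m ∈ recSpace K N q k) (hm0 : m ≠ 0) :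
    ∃ m₁ : K[X], m₁.Monic ∧ m₁.natDegree = m.natDegree ∧ m₁ ∈ recSpace K N q k ∧ m₁.coeff 0 = (m.leadingCoeff)⁻¹ * m.coeff 0 := by
  refine ⟨m * Polynomial.C (m.leadingCoeff)⁻¹, Polynomial.monic_mul_leadingCoeff_inv hm0, Polynomial.natDegree_mul_leadingCoeff_inv m hm0, ?_, ?_⟩
  · rw [mul_comm, Polynomial.C_mul']
    exact Submodule.smul_mem _ _ hm
  · rw [Polynomial.coeff_mul_C, mul_comm]

/-! ## §527. Truncation: dropping the top coefficient removes one point at infinity -/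

/-- **DROPPING THE TOP COEFFICIENT REMOVES ONE POINT AT INFINITY: if on `[0, N + 1]` the class has middle rank `d + e` (`e ≥ 1`) with a non-zero recurrence `m` of degree `d` in the
window `d + e + 1`, then on `[0, N]` it has middle rank `d + (e − 1)`, and `m` is still a recurrence in the window `d + e`** (`2(d + e) ≤ N + 2`; N34's structure theorem read at the two
levels: the affine part and the tail are the same, the tail's order counted from the new top is one less). -/
theorem rank_half_of_succ_of_polar {d e : ℕ} {q : ℕ → K} {m : K[X]} (he : 1 ≤ e) (hm0 : m ≠ 0) (hmd : m.natDegree = d)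
    (hq : (hankel1 K (N + 1) ((N + 1) / 2) q).rank = d + e) (hm : m ∈ recSpace K (N + 1) q (d + e)) (h2 : d + e + (d + e) ≤ N + 2) :
    (hankel1 K N (N / 2) q).rank = d + (e - 1) ∧ m ∈ recSpace K N q (d + (e - 1)) := by
  refine ⟨?_, (mem_recSpace_succ_succ_iff K ((mem_degreeLT_succ_iff K).mpr (by omega))).mp (by rwa [show d + (e - 1) + 1 = d + e by omega])⟩
  obtain ⟨m₁, hmo, hdeg, hm₁, -⟩ := exists_monic_mem_recSpace K hm hm0
  rw [hmd] at hdeg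
  obtain ⟨a, τ, hcop, ha, hτ, hτe, h⟩ := (rank_half_eq_and_mem_recSpace_iff_exists_affine_polar K (N := N + 1) hmo he (by rw [hdeg]; omega) q).mp
    ⟨by rw [hdeg]; exact hq, by rw [hdeg]; exact hm₁⟩
  rcases Nat.lt_or_ge 1 e with h1 | h1
  · -- order `e − 1 ≥ 1` from the new top: the same tail, the same non-zero coefficient `τ_{N+2−e}`
    have key := (rank_half_eq_and_mem_recSpace_iff_exists_affine_polar K (N := N) hmo (e := e - 1) (by omega) (by rw [hdeg]; omega) q).mpr
      ⟨a, τ, hcop, ha, fun j hj => hτ j (by omega), by rw [show N + 1 - (e - 1) = N + 1 + 1 - e by omega]; exact hτe, fun j hj => h j (by omega)⟩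
    rw [hdeg] at key
    exact key.1
  · -- `e = 1`: the tail is `τ_{N+1}` alone, invisible on `[0, N]`
    have he1 : e = 1 := by omega
    subst he1
    have key := (rank_half_eq_and_mem_recSpace_iff_exists_affine K (N := N) hmo (by rw [hdeg]; omega) q).mpr
      ⟨a, hcop, ha, fun j hj => by rw [h j (by omega), hτ j (by omega), add_zero]⟩
    rw [hdeg] at key
    simpa using key.1

/-- **NO NODE AT INFINITY, NOTHING LOST: if on `[0, N + 1]` the class has middle rank `d` with a non-zero recurrence of FULL degree `d` in the window `d + 1`, then its middle rank on `[0, N]`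
is still `d`** (`2d ≤ N + 1`), and `m` stays a recurrence. -/
theorem rank_half_of_succ_of_affine {d : ℕ} {q : ℕ → K} {m : K[X]} (hm0 : m ≠ 0) (hmd : m.natDegree = d)
    (hq : (hankel1 K (N + 1) ((N + 1) / 2) q).rank = d) (hm : m ∈ recSpace K (N + 1) q d) (h2 : d + d ≤ N + 1) :
    (hankel1 K N (N / 2) q).rank = d ∧ m ∈ recSpace K N q d := by
  refine ⟨?_, recSpace_succ_le K q d hm⟩
  obtain ⟨m₁, hmo, hdeg, hm₁, -⟩ := exists_monic_mem_recSpace K hm hm0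
  rw [hmd] at hdeg
  obtain ⟨a, hcop, ha, h⟩ := (rank_half_eq_and_mem_recSpace_iff_exists_affine K (N := N + 1) hmo (by rw [hdeg]; omega) q).mp
    ⟨by rw [hdeg]; exact hq, by rw [hdeg]; exact hm₁⟩
  have key := (rank_half_eq_and_mem_recSpace_iff_exists_affine K (N := N) hmo (by rw [hdeg]; omega) q).mpr ⟨a, hcop, ha, fun j hj => h j (by omega)⟩
  rw [hdeg] at key
  exact key.1

/-! ## §528. The shift: dropping `q_0` removes one point at the node `0` -/

/-- `σq = rev_N (rev_{N+1} q)` on `[0, N]`. -/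
theorem shift_eq_rev_rev (q : ℕ → K) {j : ℕ} (hj : j ≤ N) : shift K q j = rev K N (rev K (N + 1) q) j := by
  rw [shift_apply, rev_apply_of_le K hj, rev_apply_of_le K (by omega), show N + 1 - (N - j) = j + 1 by omega]

/-- the constant term of `m` is the top coefficient of its reflection: `m(0) ≠ 0`, `deg m ≤ r ⇒ deg (reflect_r m) = r`. -/
theorem natDegree_reflect_eq_of_coeff_zero_ne {r : ℕ} {m : K[X]} (hmr : m.natDegree ≤ r) (h0 : m.coeff 0 ≠ 0) : (Polynomial.reflect r m).natDegree = r := by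
  refine le_antisymm (Polynomial.natDegree_reflect_le.trans (max_le le_rfl hmr)) ?_
  refine Polynomial.le_natDegree_of_ne_zero ?_
  rwa [Polynomial.coeff_reflect, Polynomial.revAt_le le_rfl, Nat.sub_self]

/-- … and `m(0) = 0`, `m ≠ 0 ⇒ deg (reflect_r m) < r` (for `deg m ≤ r`, `1 ≤ r`). -/
theorem natDegree_reflect_lt_of_coeff_zero_eq {r : ℕ} {m : K[X]} (hmr : m.natDegree ≤ r) (hr : 1 ≤ r) (h0 : m.coeff 0 = 0) : (Polynomial.reflect r m).natDegree < r := by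
  have hle : (Polynomial.reflect r m).natDegree ≤ r := Polynomial.natDegree_reflect_le.trans (max_le le_rfl hmr)
  rcases hle.lt_or_eq with hlt | heq
  · exact hlt
  · exfalso
    rcases eq_or_ne (Polynomial.reflect r m) 0 with hz | hz
    · rw [hz, Polynomial.natDegree_zero] at heq; omega
    · have hlead := Polynomial.leadingCoeff_ne_zero.mpr hz
      rw [Polynomial.leadingCoeff, heq, Polynomial.coeff_reflect, Polynomial.revAt_le le_rfl, Nat.sub_self] at hlead
      exact hlead h0

/-- the reversed class on `[0, N + 1]`: same middle rank, reflected minimal recurrence (N38), packaged with the window. -/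
theorem rank_half_rev_succ_and_reflect_mem {r : ℕ} {q : ℕ → K} {m : K[X]} (hq : (hankel1 K (N + 1) ((N + 1) / 2) q).rank = r)
    (hm : m ∈ recSpace K (N + 1) q r) (hm0 : m ≠ 0) (h2 : r + r ≤ N + 2) :
    (hankel1 K (N + 1) ((N + 1) / 2) (rev K (N + 1) q)).rank = r ∧ Polynomial.reflect r m ∈ recSpace K (N + 1) (rev K (N + 1) q) r ∧ Polynomial.reflect r m ≠ 0 := by
  obtain ⟨m₀, hm₀0, hspan⟩ := exists_recSpace_self_eq_span K hq h2
  have hline : recSpace K (N + 1) q r = K ∙ m := by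
    rw [hspan] at hm ⊢
    obtain ⟨c, rfl⟩ := Submodule.mem_span_singleton.mp hm
    have hc : c ≠ 0 := by rintro rfl; exact hm0 (zero_smul _ _)
    exact (Submodule.span_singleton_smul_eq (IsUnit.mk0 c hc) m₀).symm
  have hrev := recSpace_rev_eq_span_reflect K hline (natDegree_le_of_mem_recSpace K hm)
  refine ⟨by rw [rank_hankel1_half_rev, hq], by rw [hrev]; exact Submodule.mem_span_singleton_self _, fun h0 => hm0 ?_⟩
  rw [← Polynomial.reflect_reflect (N := r) (p := m), h0, Polynomial.reflect_zero]

/-- **THE SHIFT KEEPS THE MIDDLE RANK WHEN `0` IS NOT A NODE: `R^{N+1}(q) = r`, `0 ≠ m ∈ Rec^{N+1}_r(q)` with `m(0) ≠ 0`, `2r ≤ N + 1 ⇒ R^N(σq) = r`** (reverse, truncate the top — which now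
holds the node `0` of `q`, absent —, reverse back). -/
theorem rank_half_shift_of_coeff_zero_ne {r : ℕ} {q : ℕ → K} {m : K[X]} (hq : (hankel1 K (N + 1) ((N + 1) / 2) q).rank = r) (hm : m ∈ recSpace K (N + 1) q r) (hm0 : m ≠ 0)
    (h0 : m.coeff 0 ≠ 0) (h2 : r + r ≤ N + 1) : (hankel1 K N (N / 2) (shift K q)).rank = r := by
  obtain ⟨hq', hm', hm'0⟩ := rank_half_rev_succ_and_reflect_mem K hq hm hm0 (by omega)
  have hdeg : (Polynomial.reflect r m).natDegree = r := natDegree_reflect_eq_of_coeff_zero_ne K (natDegree_le_of_mem_recSpace K hm) h0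
  have key := (rank_half_of_succ_of_affine K hm'0 hdeg hq' hm' h2).1
  rw [rank_hankel1_half_congr K (fun j hj => shift_eq_rev_rev K q hj), rank_hankel1_half_rev, key]

/-- **THE SHIFT REMOVES ONE POINT AT THE NODE `0`: `R^{N+1}(q) = r ≥ 1`, `0 ≠ m ∈ Rec^{N+1}_r(q)` with `m(0) = 0`, `2r ≤ N + 2 ⇒ R^N(σq) + 1 = r`** (after reversal the root `0` of `m` is a
degree drop of `reflect_r m`, i.e. a node at infinity, which the truncation peels off once). -/
theorem rank_half_shift_of_coeff_zero_eq {r : ℕ} {q : ℕ → K} {m : K[X]} (hq : (hankel1 K (N + 1) ((N + 1) / 2) q).rank = r) (hm : m ∈ recSpace K (N + 1) q r) (hm0 : m ≠ 0)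
    (h0 : m.coeff 0 = 0) (hr : 1 ≤ r) (h2 : r + r ≤ N + 2) : (hankel1 K N (N / 2) (shift K q)).rank + 1 = r := by
  obtain ⟨hq', hm', hm'0⟩ := rank_half_rev_succ_and_reflect_mem K hq hm hm0 h2
  have hlt : (Polynomial.reflect r m).natDegree < r := natDegree_reflect_lt_of_coeff_zero_eq K (natDegree_le_of_mem_recSpace K hm) hr h0
  -- degree `d = deg (reflect_r m)`, drop `e + 1 = r − d ≥ 1`
  obtain ⟨e, he⟩ := Nat.exists_eq_add_of_lt hlt
  have hq'' : (hankel1 K (N + 1) ((N + 1) / 2) (rev K (N + 1) q)).rank = (Polynomial.reflect r m).natDegree + (e + 1) := by rw [hq']; omega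
  have hm'' : Polynomial.reflect r m ∈ recSpace K (N + 1) (rev K (N + 1) q) ((Polynomial.reflect r m).natDegree + (e + 1)) := by
    rw [show (Polynomial.reflect r m).natDegree + (e + 1) = r by omega]; exact hm'
  have key := (rank_half_of_succ_of_polar K (Nat.le_add_left 1 e) hm'0 rfl hq'' hm'' (by omega)).1
  rw [rank_hankel1_half_congr K (fun j hj => shift_eq_rev_rev K q hj), rank_hankel1_half_rev, key]
  omega

end Summit.Ventures.HSemireg.Wedge.HankelOuter
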